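import Summits.CriticalPhenomena.Ising3DConformalLimit.Theses.AnomalousForcesInteraction
import Summits.CriticalPhenomena.Ising3DConformalLimit.Theorems.OctaveForgettingEtaFromForgetting2
import Summits.CriticalPhenomena.Ising3DConformalLimit.Theorems.OctaveForgettingForgettingComposes
import Summits.CriticalPhenomena.Ising3DConformalLimit.Theorems.OctaveForgettingSphereCovarianceLowerBound
import Summits.CriticalPhenomena.Ising3DConformalLimit.Theorems.OctaveForgettingSphereVarianceUpperBound
import Summits.CriticalPhenomena.Ising3DConformalLimit.Theorems.AnomalousForcesInteractionEtaPositiveExponentBridge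
import Literature.MathematicalPhysics.QuantumFieldTheory.CFTAxioms
import Literature.Probability.LatticeModels.MeanFieldLowerBound
import Literature.Probability.LatticeModels.CriticalTwoPointBounds
import Literature.Probability.LatticeModels.MagnetizationExponentUpper
import HarnessLib

/-!
# Crux `EtaPositive` (stmt-CriticalPhenomena-2600): its registered producer, the master conjecture,
# and the exponent-free endpoint of its open stub

Route `AnomalousForcesInteraction` (Ising3DConformalLimit), crux (AP)
`EtaPositive := ∃ κ C, 0 < κ ∧ ∀ x ≠ 0, ⟨σ₀σ_x⟩⁺_{β_c(3)} ≤ C ‖x‖^{-(1+κ)}` ("`η(3) > 0` in upper-bound form").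
The crux's only line (`Cruxes/EtaPositive/Lines/birth.lean`, slug `registered`) is closed modulo ONE stub,
`stub_isothermGain` ("`1/δ > 1/5` on `ℤ³` in upper-bound form": `m(β_c(3),h) ≤ A h^b` on `(0,h₀]` for some `b > 1/5`),
an open problem with no engine in the tree or in print (seven lead seats; `Cruxes/EtaPositive/PROMOTE.md`,
`Cruxes/EtaPositive/Lines/registered-dead.md`). This file records, as theorems about the genuine `ℤ³` model, three
facts that fix the crux's standing in the tree WITHOUT repeating the five conditional closings already landed
(`EtaPositive_of_isothermGain`, `…_of_oneArmGain`, `…_of_hasIsingExponentDelta_lt_five`,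
`etaPositive_of_hasIsingExponentEta_pos`, `…_of_thermalRates`):

* `EtaPositive_iff_octaveForgetting_target`, `EtaPositive_of_sphereForgetting` — the crux is, verbatim, the `Target`
  of the sibling route `OctaveForgetting`, whose whole support chain is LANDED (`forgettingComposes_proof`,
  `SphereCovarianceLowerBound_proof`, `SphereVarianceUpperBound_proof`, `EtaFromForgetting2_proof`); hence the crux is
  CLOSED MODULO the existing open statement item stmt-CriticalPhenomena-8103 `OctaveForgetting.SphereForgetting`
  ("lattice `L`-ades forget more than the free field's `1/L`": maximal-correlation contraction `ρ² ≤ θ < 1/L` along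
  the shell Markov chain at `β_c(3)`) — the one registered producer of the crux that carries an engine.
* `EtaPositive_of_critIsing3DExponentValues` — the registered master conjecture **crit-ising.S23**
  (`CritIsing3DExponentValues`: `η = 2Δ_σ - 1 ∈ [0.0362958, 0.0362998]`) implies the crux (consistency link only:
  S23 contains the summit statement, so it is never a discharge target).
* `magnetizationInField_criticalBeta_tendsto_zero` (`d ≥ 3`) and `magnetizationInField_criticalBeta_three_eventually_le`
  — the exponent-FREE endpoint of `stub_isothermGain` that IS a theorem today: the critical isotherm vanishes
  continuously, `m(β_c(d),h) → 0` as `h ↓ 0` (Aizenman–Duminil-Copin–Sidoravicius 2015, `m*(β_c) = 0`, tree theorem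
  `spontaneousMagnetization_criticalBeta_eq_zero_holds`, plus right-continuity of the plus state in the field,
  `plusCorr_continuousWithinAt_Ici_field`, Friedli–Velenik Lemma 3.31). In the stub's own shape: for every `ε > 0`
  there is `h₀ > 0` with `m(β_c(3),h) ≤ ε` on `(0,h₀]` — i.e. "`b = 0` with arbitrarily small amplitude"; ANY rate
  `b > 0` is open in print (arXiv:2510.23423, after Thm. 1.12, via the ghost-field reduction), and `b > 1/5` is the stub.

No named fact is assumed; axioms are the standard three.
-/

noncomputable section

namespace Summit.CriticalPhenomena.Ising3DConformalLimit.AnomalousForcesInteractionEtaPositive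

open Literature.Probability.LatticeModels Filter Set
open scoped Topology

/-! ### The crux is the `Target` of route `OctaveForgetting`, produced there by `SphereForgetting` -/

/-- The crux `AnomalousForcesInteraction.EtaPositive` (stmt-CriticalPhenomena-2600) and the `Target` of the sibling
route `OctaveForgetting` are the same proposition, verbatim (`Iff.rfl`); the ledger records the item as shared
between the two routes. [folklore] -/
theorem EtaPositive_iff_octaveForgetting_target :
    Summit.CriticalPhenomena.Ising3DConformalLimit.Theses.AnomalousForcesInteraction.EtaPositive ↔
      Summit.CriticalPhenomena.Ising3DConformalLimit.Theses.OctaveForgetting.Target :=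
  Iff.rfl

/-- **The crux is closed modulo the existing item stmt-CriticalPhenomena-8103.** `OctaveForgetting.SphereForgetting`
(maximal-correlation contraction `Cov² ≤ θ·Var·Var`, `θL < 1`, between the spin σ-algebras of the lattice spheres
`S_r` and `S_{Lr}` under the critical Gibbs measure of `ℤ³`) implies `EtaPositive`, by composing the four LANDED
support theorems of route `OctaveForgetting`: maximal correlations multiply along the shell Markov chain
(`forgettingComposes_proof`), the sphere covariance lower bound `c R² G(3Re₁) ≤ Cov(σ₀, Σ_{S_R} σ)`
(`SphereCovarianceLowerBound_proof`, GKS + Messager–Miracle-Solé), the sphere variance upper bound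
`Var(Σ_{S_R} σ) ≤ C R³` (`SphereVarianceUpperBound_proof`, infrared bound), and the glue `EtaFromForgetting2_proof`
(geometric decay along `L`-ades ⟹ power law with exponent `1 + κ`, `κ = log(1/θ)/log L - 1 > 0`). [folklore] -/
theorem EtaPositive_of_sphereForgetting : Summit.CriticalPhenomena.Ising3DConformalLimit.Theses.OctaveForgetting.SphereForgetting → Summit.CriticalPhenomena.Ising3DConformalLimit.Theses.AnomalousForcesInteraction.EtaPositive :=
  fun hSF => Theorems.EtaFromForgetting2_proof hSF Theorems.forgettingComposes_proof
    Theorems.SphereCovarianceLowerBound_proof Theorems.SphereVarianceUpperBound_proof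

/-! ### The registered master conjecture crit-ising.S23 implies the crux (consistency link) -/

/-- **crit-ising.S23 ⟹ the crux** (consistency link; S23 is a registered OPEN conjecture containing the summit
statement, never a discharge target): `CritIsing3DExponentValues` pins `η(3) = 2Δ_σ - 1 ∈ [0.0362958, 0.0362998]`
(`CritIsing3DExponentValues.exists_hasIsingExponentEta`), in particular `η(3) > 0` in the logarithmic sense, which
already gives the power upper bound with `κ = η/2` (`etaPositive_of_hasIsingExponentEta_pos`).
(Kos–Poland–Simmons-Duffin–Vichi 2016, §1: `η = 0.0362978(20)`.) [cite: KosPolandSimmonsDuffinVichi2016, §1] -/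
theorem EtaPositive_of_critIsing3DExponentValues
    (H : Literature.MathematicalPhysics.QuantumFieldTheory.CritIsing3DExponentValues) :
    Summit.CriticalPhenomena.Ising3DConformalLimit.Theses.AnomalousForcesInteraction.EtaPositive := by
  obtain ⟨η, ⟨hη1, -⟩, hη⟩ := H.exists_hasIsingExponentEta
  exact etaPositive_of_hasIsingExponentEta_pos (lt_of_lt_of_le (by norm_num) hη1) hη

/-! ### The exponent-free endpoint of `stub_isothermGain`: the critical isotherm vanishes continuously -/

/-- **The critical isotherm vanishes continuously at `h = 0⁺`, `d ≥ 3`:** `m(β_c(d), h) → 0` as `h ↓ 0`.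
Continuity of the magnetisation at `β_c` (Aizenman–Duminil-Copin–Sidoravicius, CMP 334 (2015), Thm. 1.2 with
Cor. 1.5 (1): `m*(β_c) = 0` for the nearest-neighbour model in `d ≥ 3`; tree theorem
`spontaneousMagnetization_criticalBeta_eq_zero_holds`) combined with the right-continuity of
`h ↦ ⟨σ₀⟩⁺_{β,h}` at `h = 0` (Friedli–Velenik 2017, Lemma 3.31 (1); tree theorem
`plusCorr_continuousWithinAt_Ici_field`) and `m(β,0) = m*(β)`. This is the exponent-free (`b = 0`) endpoint of the
open stub `stub_isothermGain`; no RATE of vanishing is known on `ℤ³`.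
[cite: AizenmanDuminilCopinSidoraviciusCMP2015, Thm. 1.2 with Cor. 1.5 (1)] [cite: FriedliVelenik2017, Lemma 3.31 (1), p. 119] -/
theorem magnetizationInField_criticalBeta_tendsto_zero {d : ℕ} (hd : 3 ≤ d) :
    Tendsto (fun h : ℝ => magnetizationInField d (criticalBeta d) h) (𝓝[>] 0) (𝓝 0) := by
  have hrc := plusCorr_continuousWithinAt_Ici_field (d := d) (criticalBeta_nonneg d) {0} le_rfl
  have h0 : plusCorr d (criticalBeta d) 0 {0} = 0 := by
    rw [← spontaneousMagnetization_eq_plusCorr]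
    exact spontaneousMagnetization_criticalBeta_eq_zero_holds hd
  have h1 : Tendsto (fun h : ℝ => plusCorr d (criticalBeta d) h {0}) (𝓝[>] 0) (𝓝 0) := by
    have h2 := hrc.tendsto.mono_left (nhdsWithin_mono (0 : ℝ) Set.Ioi_subset_Ici_self)
    rwa [h0] at h2
  refine h1.congr' (Eventually.of_forall fun h => ?_)
  exact (magnetizationInField_eq_plusCorr (d := d) (criticalBeta d) h).symm

/-- **The `b = 0` endpoint of `stub_isothermGain`, in the stub's own shape:** for every `ε > 0` there is
`h₀ > 0` such that `m(β_c(3), h) ≤ ε` for all `h ∈ (0, h₀]` (from `magnetizationInField_criticalBeta_tendsto_zero`).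
The registered stub asks instead for `m(β_c(3),h) ≤ A h^b` with some `b > 1/5`; any `b > 0` is open in print.
[cite: AizenmanDuminilCopinSidoraviciusCMP2015, Thm. 1.2 with Cor. 1.5 (1)] -/
theorem magnetizationInField_criticalBeta_three_eventually_le : ∀ {ε : ℝ}, 0 < ε → ∃ h₀ : ℝ, 0 < h₀ ∧ ∀ h : ℝ, 0 < h → h ≤ h₀ → magnetizationInField 3 (criticalBeta 3) h ≤ ε := by
  intro ε hε
  have ht := magnetizationInField_criticalBeta_tendsto_zero (d := 3) le_rfl
  have hev : ∀ᶠ h : ℝ in 𝓝[>] 0, magnetizationInField 3 (criticalBeta 3) h < ε :=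
    ht.eventually (gt_mem_nhds hε)
  rw [Filter.Eventually, mem_nhdsGT_iff_exists_Ioc_subset] at hev
  obtain ⟨u, hu, hsub⟩ := hev
  refine ⟨u, hu, fun h hh hhu => le_of_lt ?_⟩
  exact hsub ⟨hh, hhu⟩

end Summit.CriticalPhenomena.Ising3DConformalLimit.AnomalousForcesInteractionEtaPositive

end
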